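import Summits.BirchSwinnertonDyer.BirchSwinnertonDyer.Theorems.GenusKolyvaginAtTwoGenusPrimitiveSupplyAtTwoPrimeTwistNormCore
import Literature.NumberTheory.EllipticCurves.Kramer1981.RamifiedOddGoodNormIndexProofs
import HarnessLib

/-!
# Route `GenusKolyvaginAtTwo`, crux #2 `GenusPrimitiveSupplyAtTwo` (stmt-BirchSwinnertonDyer-22136):
# THE RAMIFIED PLACE of the prime-twist dictionary — `H¹_f(K_v) ∩ H¹_𝒜(K_v) = 0` at an odd place of good reduction ramified in `K(√d)`

Width seat `bsd-line-gk2-p5` g14 (cell `bsd-f1-sign2`, SUPPLY lineage of crux 22136), file 37b of the series; sequel of `…PrimeTwistNormCore` (the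
cocycle core «norms are doubles ⟹ `H¹_f ∩ H¹_𝒜 = 0`»). THEOREMS ONLY (no definition, no named fact, no `sorry`); helper
`--supports stmt-BirchSwinnertonDyer-22136`; no item is closed; BSD is not proved by any of this.

WHAT (Kramer 1981 Prop. 3 / Mazur–Rubin 2010 Lemma 2.11 in prime-twist currency, `p = 2`).
* §161a `exists_fixed_add_self_eq_norm_of_hasGoodReductionAt_ramified` — on `K'`-points of `W ⊗ K_v` (`W` good at `v ∤ 2`, `K' ⊆ K̄_v` a RAMIFIED
  quadratic extension of `K_v`): every norm `A + σA` is `P + P` with `P` `σ`-fixed — Kramer's `N E(K') = ι(2 E(K_v))`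
  (`Kramer1981.normSubgroup_eq_map_range_two_ramified`, PROVED in the tree) on a unit-discriminant model, transported along the substitution.
* §161b `exists_fixed_add_self_of_forall_norm` — the geometric form over any perfect `K`-field `F` with `K' = F(ι√d)`: points fixed by the
  stabiliser of `ι√d` descend to `K'` (file 31), `σ`-fixed `K'`-points are fixed by all of `Γ_F` (which acts on `K'` as `1` or `σ`).
* §161c `forall_exists_two_nsmul_of_hasGoodReductionAt_of_not_mem_maxUnramified` — the norm input `hnorm2` of the core on `localPoints W K_v`.
* §162 **`res_eq_zero_of_mem_selmerLocalKer_of_mem_primeTwist_selmerLocalKer_ramified`** — THE RAMIFIED BRICK: `W` good at `v`, residue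
  characteristic odd, `ι√d ∉ K_v^{nr}`, `χ|_{Γ_{K_v}}` the character of `K_v(ι√d)` ⟹ a class in `E`'s Kummer condition and in `A_χ`'s `𝔓`-Selmer
  condition at `K_v` restricts to `0` in `H¹(K_v, E[2])` (MR 2010 Lemma 2.11: `H¹_f ∩ H¹_f^χ = 0` at such places).

Honest framing: KNOWN in print; kernel-new; beyond-print theorem: no. Crux 22136 stays OPEN exactly at (U) 24947 ∧ (CONV₂) 19220/24948.
BSD is not proved by any of this.

References: [Kramer1981] Prop. 3 (p. 125), Prop. 7; [MazurRubin2010] Lemma 2.11; [MazurRubin2007] Prop. 5.2; [SilvermanAEC2009] VIII.§1.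
-/

set_option linter.dupNamespace false -- tree convention: `Summit.BirchSwinnertonDyer.BirchSwinnertonDyer.Theorems` (summit = sub-problem)
set_option autoImplicit false

noncomputable section

open scoped Classical ValuativeRel

namespace Summit.BirchSwinnertonDyer.BirchSwinnertonDyer.Theorems.GenusKolyArch

open WeierstrassCurve Field NumberField IsDedekindDomain Function
open Literature.NumberTheory.EllipticCurves Literature.NumberTheory.GaloisRepresentations
open Literature.NumberTheory.GaloisCohomology
open Literature.NumberTheory.GaloisRepresentations.IsNonarchimedeanLocalField (maxUnramified)
open Literature.NumberTheory.EllipticCurves.KramerTunnell1982 (normSubgroup fixedSubgroup mem_normSubgroup_iff)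

/-! ## §161a Kramer's `N E(K') = ι(2 E(K_v))` on `K'`-points of `W ⊗ K_v` -/

section KPrime

variable {K : Type} [Field K] [NumberField K] (W : WeierstrassCurve K) [W.IsElliptic] (v : HeightOneSpectrum (𝓞 K))

omit [W.IsElliptic] in
/-- **Norms from a ramified quadratic `K'` are doubles of `σ`-fixed points** on `(W ⊗ K_v)(K')`, `W` good at `v`, residue characteristic odd,
`K' = K_v(x)`, `x² = d' ∉ K_v²`, `K' ⊄ K_v^{nr}`, `σ ≠ 1`: every `A + σA` is `P + P` with `σP = P` (Kramer's `N E(K') = ι(2E(F))` on a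
unit-discriminant model over `𝒪[K_v]`, transported along the `σ`-equivariant substitution). [cite: Kramer1981, §2 Prop. 3 (p. 125)] -/
theorem exists_fixed_add_self_eq_norm_of_hasGoodReductionAt_ramified (hv : W.HasGoodReductionAt v)
    (hodd : ringChar (IsLocalRing.ResidueField 𝒪[v.adicCompletion K]) ≠ 2)
    {K' : IntermediateField (v.adicCompletion K) (AlgebraicClosure (v.adicCompletion K))}
    (h2 : Module.finrank (v.adicCompletion K) K' = 2) (hram : ¬ K' ≤ maxUnramified (v.adicCompletion K))
    {d' : v.adicCompletion K} (hd' : ¬ IsSquare d') {x : K'} (hx : x ^ 2 = algebraMap (v.adicCompletion K) K' d')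
    {σ : K' ≃ₐ[v.adicCompletion K] K'} (hσ : σ ≠ 1)
    (A₂ : ((W.baseChange (v.adicCompletion K)).baseChange K').toAffine.Point) :
    ∃ P₂ : ((W.baseChange (v.adicCompletion K)).baseChange K').toAffine.Point,
      Affine.Point.map (W' := W.baseChange (v.adicCompletion K)) (σ : K' →ₐ[v.adicCompletion K] K') P₂ = P₂ ∧
        A₂ + Affine.Point.map (W' := W.baseChange (v.adicCompletion K)) (σ : K' →ₐ[v.adicCompletion K] K') A₂ = P₂ + P₂ := by
  haveI : CharZero (v.adicCompletion K) := charZero_of_injective_algebraMap (algebraMap K _).injective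
  obtain ⟨M, C, hΔ, hM⟩ := exists_integer_model_of_hasGoodReductionAt W v hv
  -- on the unit-discriminant model `M ⊗ K_v = C • (W ⊗ K_v)`
  have hH₁ : ∀ A₁ : ((C • W.baseChange (v.adicCompletion K)).baseChange K').toAffine.Point,
      ∃ P₁ : ((C • W.baseChange (v.adicCompletion K)).baseChange K').toAffine.Point,
        Affine.Point.map (W' := C • W.baseChange (v.adicCompletion K)) (σ : K' →ₐ[v.adicCompletion K] K') P₁ = P₁ ∧
          A₁ + Affine.Point.map (W' := C • W.baseChange (v.adicCompletion K)) (σ : K' →ₐ[v.adicCompletion K] K') A₁ = P₁ + P₁ := by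
    rw [← hM]
    intro A₁
    have hmem : A₁ + Affine.Point.map (W' := M.baseChange (v.adicCompletion K)) (σ : K' →ₐ[v.adicCompletion K] K') A₁ ∈
        normSubgroup (M.baseChange (v.adicCompletion K)) K' σ := mem_normSubgroup_iff.mpr ⟨A₁, rfl⟩
    rw [Kramer1981.normSubgroup_eq_map_range_two_ramified hodd M hΔ h2 hram hd' hx hσ] at hmem
    obtain ⟨R₀, ⟨P₀, rfl⟩, hR₀⟩ := AddSubgroup.mem_map.mp hmem
    refine ⟨Affine.Point.baseChange (W' := M.baseChange (v.adicCompletion K)) (v.adicCompletion K) K' P₀,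
      Affine.Point.map_baseChange (W' := M.baseChange (v.adicCompletion K)) (σ : K' →ₐ[v.adicCompletion K] K') P₀, ?_⟩
    rw [← hR₀, nsmulAddMonoidHom_apply, map_nsmul, two_nsmul]
  -- transport along `e : (W ⊗ K_v)(K') ≃+ (C • (W ⊗ K_v))(K')`
  set e := VariableChange.pointEquivBaseChange (W.baseChange (v.adicCompletion K)) C K' with he
  have heσ : ∀ P : ((W.baseChange (v.adicCompletion K)).baseChange K').toAffine.Point,
      e (Affine.Point.map (W' := W.baseChange (v.adicCompletion K)) (σ : K' →ₐ[v.adicCompletion K] K') P) =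
        Affine.Point.map (W' := C • W.baseChange (v.adicCompletion K)) (σ : K' →ₐ[v.adicCompletion K] K') (e P) :=
    fun P ↦ VariableChange.pointEquivBaseChange_map_algEquiv (W.baseChange (v.adicCompletion K)) C σ P
  obtain ⟨P₁, hP₁fix, hP₁⟩ := hH₁ (e A₂)
  refine ⟨e.symm P₁, e.injective ?_, e.injective ?_⟩
  · rw [heσ, AddEquiv.apply_symm_apply, hP₁fix]
  · rw [map_add, heσ, hP₁, map_add, AddEquiv.apply_symm_apply]

end KPrime

/-! ## §161b The geometric form over a perfect `K`-field `F` with `K' = F(ι√d)` -/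

section Geometric

variable {K : Type} [Field K] {d : K} (F : Type) [Field F] [Algebra K F] [PerfectField F] (V : WeierstrassCurve F)

/-- **From «norms are doubles of `σ`-fixed points» on `F(ι√d)`-points to geometric points.** If `σ ∈ Aut(F(ι√d)/F)` and `τ₀ ∈ Γ_F` both send
`ι√d ↦ −ι√d`, and every `A₂ ∈ V(F(ι√d))` has `A₂ + σA₂ = P₂ + P₂` with `σP₂ = P₂`, then every geometric point `A` fixed by the stabiliser of `ι√d`
has `A + τ₀A = N + N` with `N` fixed by ALL of `Γ_F` (an element of `Γ_F` acts on `F(ι√d)` as `1` or as `σ`). [cite: SilvermanAEC2009, VIII.§1]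
[cite: Kramer1981, Prop. 7] -/
theorem exists_fixed_add_self_of_forall_norm
    (σ : (IntermediateField.adjoin F {closureEmb (K := K) F (geomSqrt d)}) ≃ₐ[F] (IntermediateField.adjoin F {closureEmb (K := K) F (geomSqrt d)}))
    (hσ : ((σ (IntermediateField.AdjoinSimple.gen F (closureEmb (K := K) F (geomSqrt d))) :
        (IntermediateField.adjoin F {closureEmb (K := K) F (geomSqrt d)})) : AlgebraicClosure F) = -closureEmb (K := K) F (geomSqrt d))
    {τ₀ : absoluteGaloisGroup F}
    (hτ₀ : (show AlgebraicClosure F ≃ₐ[F] AlgebraicClosure F from τ₀) (closureEmb (K := K) F (geomSqrt d)) = -closureEmb (K := K) F (geomSqrt d))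
    (hH : ∀ A₂ : (V.baseChange (IntermediateField.adjoin F {closureEmb (K := K) F (geomSqrt d)})).toAffine.Point,
      ∃ P₂ : (V.baseChange (IntermediateField.adjoin F {closureEmb (K := K) F (geomSqrt d)})).toAffine.Point,
        Affine.Point.map (W' := V) (σ : _ →ₐ[F] (IntermediateField.adjoin F {closureEmb (K := K) F (geomSqrt d)})) P₂ = P₂ ∧
          A₂ + Affine.Point.map (W' := V) (σ : _ →ₐ[F] (IntermediateField.adjoin F {closureEmb (K := K) F (geomSqrt d)})) A₂ = P₂ + P₂)
    (A : geomPoints V)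
    (hA : ∀ g : absoluteGaloisGroup F,
      (show AlgebraicClosure F ≃ₐ[F] AlgebraicClosure F from g) (closureEmb (K := K) F (geomSqrt d)) = closureEmb (K := K) F (geomSqrt d) →
        g • A = A) :
    ∃ N : geomPoints V, (∀ g : absoluteGaloisGroup F, g • N = N) ∧ A + τ₀ • A = N + N := by
  have hτ₀' := forall_apply_eq_of_apply_adjoin_gen_eq_apply (d := d) F τ₀ σ (hτ₀.trans hσ.symm)
  have hA' : ∀ g : absoluteGaloisGroup F,
      (∀ x : (IntermediateField.adjoin F {closureEmb (K := K) F (geomSqrt d)}),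
        (show AlgebraicClosure F ≃ₐ[F] AlgebraicClosure F from g) (x : AlgebraicClosure F) = x) → g • A = A := by
    intro g hg
    apply hA g
    have := hg (IntermediateField.AdjoinSimple.gen F (closureEmb (K := K) F (geomSqrt d)))
    rwa [IntermediateField.AdjoinSimple.coe_gen] at this
  obtain ⟨A₂, rfl⟩ := exists_map_val_eq_of_forall_smul_eq V (IntermediateField.adjoin F {closureEmb (K := K) F (geomSqrt d)}) hA'
  obtain ⟨P₂, hP₂fix, hP₂⟩ := hH A₂
  refine ⟨(Affine.Point.map (W' := V) (IntermediateField.val _) P₂ : geomPoints V), fun g ↦ ?_, ?_⟩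
  · -- `g` acts on `F(ι√d)` as `1` or as `σ`; `P₂` is `σ`-fixed
    have hsq : ((show AlgebraicClosure F ≃ₐ[F] AlgebraicClosure F from g) (closureEmb (K := K) F (geomSqrt d))) ^ 2 =
        (closureEmb (K := K) F (geomSqrt d)) ^ 2 := by
      rw [← map_pow, closureEmb_geomSqrt_sq_eq_algebraMap_field F, AlgEquiv.commutes]
    rcases sq_eq_sq_iff_eq_or_eq_neg.mp hsq with hg | hg
    · exact smul_map_val_eq_self_of_forall_apply V _ g (forall_apply_eq_of_apply_adjoin_gen_eq (d := d) F g hg) P₂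
    · have hg' := forall_apply_eq_of_apply_adjoin_gen_eq_apply (d := d) F g σ (hg.trans hσ.symm)
      change Affine.Point.map (W' := V)
          ((show AlgebraicClosure F ≃ₐ[F] AlgebraicClosure F from g) : AlgebraicClosure F →ₐ[F] AlgebraicClosure F)
          (Affine.Point.map (W' := V) (IntermediateField.val _) P₂) = Affine.Point.map (W' := V) (IntermediateField.val _) P₂
      rw [smul_map_val_eq_of_forall_apply V _ g σ hg' P₂, hP₂fix]
  · change Affine.Point.map (W' := V) (IntermediateField.val _) A₂ +
        Affine.Point.map (W' := V)
          ((show AlgebraicClosure F ≃ₐ[F] AlgebraicClosure F from τ₀) : AlgebraicClosure F →ₐ[F] AlgebraicClosure F)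
          (Affine.Point.map (W' := V) (IntermediateField.val _) A₂) =
      Affine.Point.map (W' := V) (IntermediateField.val _) P₂ + Affine.Point.map (W' := V) (IntermediateField.val _) P₂
    rw [smul_map_val_eq_of_forall_apply V _ τ₀ σ hτ₀' A₂, ← map_add, hP₂, map_add]

end Geometric

/-! ## §161c The norm input `hnorm2` on `localPoints W K_v`, and §162 the ramified brick -/

section Ramified

variable {K : Type} [Field K] [NumberField K] (W : WeierstrassCurve K) [W.IsElliptic] (v : HeightOneSpectrum (𝓞 K)) {d : K}

omit [W.IsElliptic] in
/-- **«Norms from `K_v(ι√d)` are doubles of `K_v`-points» at an odd place of good reduction RAMIFIED in `K(√d)`:** `W` good at `v`, residue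
characteristic odd, `ι√d ∉ K_v^{nr}`, `τ₀ ∈ Γ_{K_v}` flipping `ι√d` ⟹ every `A ∈ W(K̄_v)` fixed by the stabiliser of `ι√d` has `A + τ₀A = N + N`
with `N` fixed by `Γ_{K_v}` (§161a + §161b, transported along the `Γ`-equivariant `baseChangeGeomPointsEquiv`). [cite: Kramer1981, §2 Prop. 3 (p. 125)] -/
theorem forall_exists_two_nsmul_of_hasGoodReductionAt_of_not_mem_maxUnramified (hv : W.HasGoodReductionAt v)
    (hodd : ringChar (IsLocalRing.ResidueField 𝒪[v.adicCompletion K]) ≠ 2)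
    (hα : closureEmb (K := K) (v.adicCompletion K) (geomSqrt d) ∉ maxUnramified (v.adicCompletion K))
    {τ₀ : absoluteGaloisGroup (v.adicCompletion K)}
    (hτ₀ : (show AlgebraicClosure (v.adicCompletion K) ≃ₐ[v.adicCompletion K] AlgebraicClosure (v.adicCompletion K) from τ₀)
        (closureEmb (K := K) (v.adicCompletion K) (geomSqrt d)) = -closureEmb (K := K) (v.adicCompletion K) (geomSqrt d)) :
    ∀ A : localPoints W (v.adicCompletion K),
      (∀ g : absoluteGaloisGroup (v.adicCompletion K),
        (show AlgebraicClosure (v.adicCompletion K) ≃ₐ[v.adicCompletion K] AlgebraicClosure (v.adicCompletion K) from g)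
            (closureEmb (K := K) (v.adicCompletion K) (geomSqrt d)) = closureEmb (K := K) (v.adicCompletion K) (geomSqrt d) →
          g • A = A) →
      ∃ N : localPoints W (v.adicCompletion K),
        (∀ g : absoluteGaloisGroup (v.adicCompletion K), g • N = N) ∧ A + τ₀ • A = N + N := by
  haveI : CharZero (v.adicCompletion K) := charZero_of_injective_algebraMap (algebraMap K _).injective
  have hd : ∀ s : v.adicCompletion K, s ^ 2 ≠ algebraMap K (v.adicCompletion K) d :=
    forall_sq_ne_of_closureEmb_geomSqrt_not_mem (v.adicCompletion K) (maxUnramified (v.adicCompletion K)) hα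
  have h2 := finrank_adjoin_closureEmb_geomSqrt_eq_two v hd
  haveI : Algebra.IsQuadraticExtension (v.adicCompletion K)
      (IntermediateField.adjoin (v.adicCompletion K) {closureEmb (K := K) (v.adicCompletion K) (geomSqrt d)}) :=
    { finrank_eq_two' := h2 }
  -- `σ := τ₀|_{K'}`, `σ(ι√d) = −ι√d`, `σ ≠ 1`
  set σ := (show AlgebraicClosure (v.adicCompletion K) ≃ₐ[v.adicCompletion K] AlgebraicClosure (v.adicCompletion K)
    from τ₀).restrictNormal
      (IntermediateField.adjoin (v.adicCompletion K) {closureEmb (K := K) (v.adicCompletion K) (geomSqrt d)}) with hσdef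
  have hσ : ((σ (IntermediateField.AdjoinSimple.gen (v.adicCompletion K)
      (closureEmb (K := K) (v.adicCompletion K) (geomSqrt d))) :
        IntermediateField.adjoin (v.adicCompletion K) {closureEmb (K := K) (v.adicCompletion K) (geomSqrt d)}) :
          AlgebraicClosure (v.adicCompletion K)) = -closureEmb (K := K) (v.adicCompletion K) (geomSqrt d) := by
    have h := AlgEquiv.restrictNormal_commutes
      (show AlgebraicClosure (v.adicCompletion K) ≃ₐ[v.adicCompletion K] AlgebraicClosure (v.adicCompletion K) from τ₀)
      (IntermediateField.adjoin (v.adicCompletion K) {closureEmb (K := K) (v.adicCompletion K) (geomSqrt d)})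
      (IntermediateField.AdjoinSimple.gen (v.adicCompletion K) (closureEmb (K := K) (v.adicCompletion K) (geomSqrt d)))
    rw [← hσdef] at h
    change ((σ _ : IntermediateField.adjoin (v.adicCompletion K) {closureEmb (K := K) (v.adicCompletion K) (geomSqrt d)}) :
      AlgebraicClosure (v.adicCompletion K)) = (show AlgebraicClosure (v.adicCompletion K) ≃ₐ[v.adicCompletion K]
        AlgebraicClosure (v.adicCompletion K) from τ₀) (closureEmb (K := K) (v.adicCompletion K) (geomSqrt d)) at h
    rw [h, hτ₀]
  have hα0 : closureEmb (K := K) (v.adicCompletion K) (geomSqrt d) ≠ 0 := by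
    intro h0
    apply hd 0
    have h := closureEmb_geomSqrt_sq_eq_algebraMap (K := K) (d := d) v
    rw [h0, zero_pow two_ne_zero, eq_comm, map_eq_zero] at h
    rw [h, zero_pow two_ne_zero]
  have hσ1 : σ ≠ 1 := by
    intro h1
    rw [h1, AlgEquiv.one_apply, IntermediateField.AdjoinSimple.coe_gen, eq_neg_iff_add_eq_zero, ← two_mul,
      mul_eq_zero] at hσ
    exact hσ.elim (fun h ↦ two_ne_zero h) hα0
  -- Kramer's hypotheses
  have hram : ¬ IntermediateField.adjoin (v.adicCompletion K) {closureEmb (K := K) (v.adicCompletion K) (geomSqrt d)} ≤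
      maxUnramified (v.adicCompletion K) := fun h ↦
    hα (h (IntermediateField.mem_adjoin_simple_self (v.adicCompletion K) _))
  have hd' : ¬ IsSquare (algebraMap K (v.adicCompletion K) d) := by
    rintro ⟨s, hs⟩
    exact hd s (by rw [sq]; exact hs.symm)
  have hx := adjoinSimple_gen_sq (d := d) v
  have hH := exists_fixed_add_self_eq_norm_of_hasGoodReductionAt_ramified W v hv hodd h2 hram hd' hx hσ1
  have hgeom := exists_fixed_add_self_of_forall_norm (v.adicCompletion K) (W.baseChange (v.adicCompletion K)) σ hσ hτ₀ hH
  -- transport to `localPoints` along the `Γ`-equivariant `baseChangeGeomPointsEquiv`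
  intro A hAfix
  set eg := W.baseChangeGeomPointsEquiv (v.adicCompletion K) with heg
  have hA' : ∀ g : absoluteGaloisGroup (v.adicCompletion K),
      (show AlgebraicClosure (v.adicCompletion K) ≃ₐ[v.adicCompletion K] AlgebraicClosure (v.adicCompletion K) from g)
          (closureEmb (K := K) (v.adicCompletion K) (geomSqrt d)) = closureEmb (K := K) (v.adicCompletion K) (geomSqrt d) →
        g • eg.symm A = eg.symm A := by
    intro g hg
    rw [← W.baseChangeGeomPointsEquiv_symm_smul (v.adicCompletion K) g A, hAfix g hg]
  obtain ⟨N', hN'fix, hN'⟩ := hgeom (eg.symm A) hA'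
  refine ⟨eg N', fun g ↦ ?_, ?_⟩
  · rw [← W.baseChangeGeomPointsEquiv_smul (v.adicCompletion K) g N', hN'fix g]
  · apply eg.symm.injective
    rw [map_add, map_add, AddEquiv.symm_apply_apply, ← hN', W.baseChangeGeomPointsEquiv_symm_smul (v.adicCompletion K) τ₀ A]

variable (χ : absoluteGaloisGroup K →ₜ* Multiplicative (ZMod 2))

/-- **THE RAMIFIED BRICK: `H¹_f(K_v, E[2]) ∩ H¹_𝒜(K_v, E[2]) = 0` at an odd place of good reduction RAMIFIED in `K(√d)`** (`W` good at `v`,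
residue characteristic odd, `ι√d ∉ K_v^{nr}`, `χ|_{Γ_{K_v}}` the character of `K_v(ι√d)`): a class of `H¹(K, E[2])` lying in `E`'s Kummer condition
and in the `𝔓`-Selmer condition of the prime twist `A_χ` at `K_v` restricts to ZERO in `H¹(K_v, E[2])` — Mazur–Rubin 2010 Lemma 2.11
(`H¹_f ∩ H¹_{f}^χ = 0` there) / Kramer Prop. 3, in prime-twist currency. [cite: MazurRubin2010, Lemma 2.11] [cite: Kramer1981, §2 Prop. 3 (p. 125) and Prop. 7] -/
theorem res_eq_zero_of_mem_selmerLocalKer_of_mem_primeTwist_selmerLocalKer_ramified (hv : W.HasGoodReductionAt v)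
    (hodd : ringChar (IsLocalRing.ResidueField 𝒪[v.adicCompletion K]) ≠ 2)
    (hα : closureEmb (K := K) (v.adicCompletion K) (geomSqrt d) ∉ maxUnramified (v.adicCompletion K))
    (hχα : ∀ τ : absoluteGaloisGroup (v.adicCompletion K), χ (resGal (K := K) (v.adicCompletion K) τ) = 1 ↔
      (show AlgebraicClosure (v.adicCompletion K) ≃ₐ[v.adicCompletion K] AlgebraicClosure (v.adicCompletion K) from τ)
        (closureEmb (K := K) (v.adicCompletion K) (geomSqrt d)) = closureEmb (K := K) (v.adicCompletion K) (geomSqrt d))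
    {c : W.galH1Torsion ((2 : ℕ) : ℤ)} (hW : c ∈ W.selmerLocalKer (v.adicCompletion K) 2)
    (hA : c ∈ PrimeTwist.selmerLocalKer W χ (v.adicCompletion K)) :
    galoisCohomology.res (W.torsionGaloisModule ((2 : ℕ) : ℤ)) (v.adicCompletion K) 1 c = 0 := by
  have hd : ∀ s : v.adicCompletion K, s ^ 2 ≠ algebraMap K (v.adicCompletion K) d :=
    forall_sq_ne_of_closureEmb_geomSqrt_not_mem (v.adicCompletion K) (maxUnramified (v.adicCompletion K)) hα
  obtain ⟨τ₀, hτ₀⟩ := exists_flip_closureEmb_geomSqrt v hd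
  exact res_eq_zero_of_mem_of_mem_of_norm_two W χ (v.adicCompletion K) hd hχα hτ₀
    (forall_exists_two_nsmul_of_hasGoodReductionAt_of_not_mem_maxUnramified W v hv hodd hα hτ₀) hW hA

end Ramified

end Summit.BirchSwinnertonDyer.BirchSwinnertonDyer.Theorems.GenusKolyArch

end
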